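import Mathlib
import Summits.Ventures.PercRepro2.TypedSplit
import Summits.Ventures.PercRepro2.OneTypedEdge
import Summits.Ventures.PercRepro2.BasePendant
import Summits.Ventures.PercRepro2.TypedPendant

/-!
# The pendant-`a₃` edge: the quadratic identity of the typed bases (blind cell PercRepro2,
night-3 g6, 2026-08-25)

For the kernel `K₃` of the covariance form (HCOV) (`HCovCubic.lean`, state form `KB` of
`OneTypedEdge.lean`), a typed edge `f = {a₃, u}` whose end `a₃` is a leaf carrying exactly the
mark `a₃` is NOT a reduction rule (`TypedPendant.lean`: two `a₃`-factors in one term), but the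
kernel is of degree `≤ 2` in the `a₃`-mask of the three copies (no term carries `a₃` in all three
copies), so the four typed bases with `f` of type `0, 1, 2, 3` satisfy ONE linear relation:

* **`KB_pendant_a3`**: on states, with `kill3` (isolate `a₃`),
  `Σ_{even} KB = Σ_{odd} KB` over the eight masks;
* **`typedCount_pendant_a3_quadratic`**: `N_{τ[f:=0]} + N_{τ[f:=2]} = N_{τ[f:=1]} + N_{τ[f:=3]}`
  on every finite graph, every marking with `a₃` a leaf at `u` (distinct from the other marks),
  every pinning and every type vector — i.e. `S₁ − S₀ = S₂ − S₃` with `S₀` the base with `a₃`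
  isolated and `S₃` the base with `a₃ := u`.

Consequence (`typedCount_pendant_a3_of_PM`): if the type-1 base dominates the isolated base
(`S₀ ≤ S₁`, the candidate row (PM) of `proofs/NIGHT3-CERT.md` §15), then `S₁ ≥ 0` follows from
`S₀ ≥ 0` (the `a₃`-inactive class, `A3InactiveTyped`, conditional on `TB14`) and `S₂ ≥ 0` from
`S₃ ≥ 0` (the instance with `f` pinned open: one typed edge fewer).
-/

namespace Summit.Ventures.PercRepro2

namespace CovForm

namespace TypedRed

open OneTyped

/-! ## Isolating `a₃` on states -/

section States

/-- The state with the mark `a₃` isolated (`a₃ ∉ C(a₁) ∪ C(a₂)`). -/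
def kill3 (s : St) : St := (s.1, s.2.1, s.2.2.1, s.2.2.2.1, s.2.2.2.2.1, false, false)

/-- `kill3` keeps `q'`. -/
@[simp] lemma kill3_q' (s : St) : (kill3 s).q' = s.q' := rfl
/-- `kill3` keeps `Lo`. -/
@[simp] lemma kill3_Lo (s : St) : (kill3 s).Lo = s.Lo := rfl
/-- `kill3` keeps `Ho`. -/
@[simp] lemma kill3_Ho (s : St) : (kill3 s).Ho = s.Ho := rfl
/-- `kill3` keeps `Lb`. -/
@[simp] lemma kill3_Lb (s : St) : (kill3 s).Lb = s.Lb := rfl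
/-- `kill3` keeps `Hb`. -/
@[simp] lemma kill3_Hb (s : St) : (kill3 s).Hb = s.Hb := rfl
/-- `kill3` clears `L3`. -/
@[simp] lemma kill3_L3 (s : St) : (kill3 s).L3 = false := rfl
/-- `kill3` clears `H3`. -/
@[simp] lemma kill3_H3 (s : St) : (kill3 s).H3 = false := rfl

/-- `1_Q` is unchanged by isolating `a₃`. -/
lemma qB_kill3 (s : St) : qB (kill3 s) = qB s := rfl

/-- With `a₃` isolated, `1_PD = 1_Q`. -/
lemma pdB_kill3 (s : St) : pdB (kill3 s) = qB s := by
  unfold pdB qB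
  simp only [kill3_q', kill3_L3, kill3_H3, Bool.or_self, Bool.false_eq_true, if_false]

/-- With `a₃` isolated, `σ₃ = 0`. -/
lemma sigB_kill3 (s : St) : sigB (kill3 s).L3 (kill3 s).H3 = 0 := rfl

/-- **The pendant-`a₃` quadratic identity on states**: `KB` is of degree `≤ 2` in the `a₃`-masks of
the three copies (every term has a mask-free factor in the `x`- or the `y`-copy), so the
alternating sum over the eight masks vanishes: the sum over the even masks equals the sum over
the odd masks. -/
theorem KB_pendant_a3 (x y z : St) :
    KB (kill3 x) (kill3 y) (kill3 z) + KB x y (kill3 z) + KB x (kill3 y) z + KB (kill3 x) y z =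
      KB x (kill3 y) (kill3 z) + KB (kill3 x) y (kill3 z) + KB (kill3 x) (kill3 y) z + KB x y z := by
  simp only [KB, pdB_kill3, qB_kill3, kill3_Lo, kill3_Ho, kill3_Lb, kill3_Hb, sigB_kill3]
  ring

end States

/-! ## The state at a pendant `a₃` -/

section Graph

open Classical

variable {V : Type*} {E : Type*} [DecidableEq E]
variable (ends : E → Sym2 V) (o a₁ a₂ a₃ b : V)

/-- At a pendant `a₃` (a leaf carrying exactly the mark `a₃`), closing the leaf edge isolates `a₃`
in the state. -/
lemma st_update_pendant_a3 {f : E} {u : V} (hf : ends f = s(a₃, u))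
    (hleaf : ∀ e, a₃ ∈ ends e → e = f) (h3u : a₃ ≠ u) (h3o : a₃ ≠ o) (h31 : a₃ ≠ a₁)
    (h32 : a₃ ≠ a₂) (h3b : a₃ ≠ b) (x : Config E) :
    st ends o a₁ a₂ a₃ b (Function.update x f false) =
      kill3 (st ends o a₁ a₂ a₃ b (Function.update x f true)) := by
  unfold st kill3
  simp only [Prod.mk.injEq]
  have hF : Function.update x f false f = false := Function.update_self f false x
  refine ⟨?_, ?_, ?_, ?_, ?_, ?_, ?_⟩
  · exact decide_eq_decide.mpr ((conn_update_leaf_iff hf hleaf h3u false h32.symm h31.symm).trans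
      (conn_update_leaf_iff hf hleaf h3u true h32.symm h31.symm).symm)
  · exact decide_eq_decide.mpr ((conn_update_leaf_iff hf hleaf h3u false h31.symm h3o.symm).trans
      (conn_update_leaf_iff hf hleaf h3u true h31.symm h3o.symm).symm)
  · exact decide_eq_decide.mpr ((conn_update_leaf_iff hf hleaf h3u false h32.symm h3o.symm).trans
      (conn_update_leaf_iff hf hleaf h3u true h32.symm h3o.symm).symm)
  · exact decide_eq_decide.mpr ((conn_update_leaf_iff hf hleaf h3u false h31.symm h3b.symm).trans
      (conn_update_leaf_iff hf hleaf h3u true h31.symm h3b.symm).symm)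
  · exact decide_eq_decide.mpr ((conn_update_leaf_iff hf hleaf h3u false h32.symm h3b.symm).trans
      (conn_update_leaf_iff hf hleaf h3u true h32.symm h3b.symm).symm)
  · exact decide_eq_false fun h => h31 (conn_leaf_closed hf hleaf h3u hF (conn_symm h)).symm
  · exact decide_eq_false fun h => h32 (conn_leaf_closed hf hleaf h3u hF (conn_symm h)).symm

end Graph

/-! ## The split at a typed edge of type `1` and of type `2` -/

section Split

variable {E : Type*} [Fintype E] [DecidableEq E] {R : Type*} [Field R]

/-- The typed count with `e ∈ F` of type `1`, through the split: the three placements of the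
single open copy. -/
lemma typedCount_split_one (F : Finset E) (e : E) (he : e ∈ F) (z : Config E) (τ : E → ℕ)
    (K : Config E → Config E → Config E → R) :
    typedCount F z (Function.update τ e 1) K =
      typedCount (F.erase e) (Function.update z e false) τ
          (fun x y w => K (Function.update x e true) (Function.update y e false)
            (Function.update w e false)) +
        typedCount (F.erase e) (Function.update z e false) τ
          (fun x y w => K (Function.update x e false) (Function.update y e true)
            (Function.update w e false)) +
        typedCount (F.erase e) (Function.update z e false) τ
          (fun x y w => K (Function.update x e false) (Function.update y e false)
            (Function.update w e true)) := by
  rw [typedCount_split F e he]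
  simp only [Fintype.sum_bool, Bool.toNat_true, Bool.toNat_false, Function.update_self]
  norm_num
  have hτ : ∀ K' : Config E → Config E → Config E → R,
      typedCount (F.erase e) (Function.update z e false) (Function.update τ e 1) K' =
        typedCount (F.erase e) (Function.update z e false) τ K' := fun K' =>
    typedCount_congr_τ _ _ (fun e' he' => by
      rw [Function.update_of_ne (Finset.ne_of_mem_erase he')]) K'
  rw [hτ, hτ, hτ]
  ring

/-- The typed count with `e ∈ F` of type `2`, through the split: the three placements of the
single closed copy. -/
lemma typedCount_split_two (F : Finset E) (e : E) (he : e ∈ F) (z : Config E) (τ : E → ℕ)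
    (K : Config E → Config E → Config E → R) :
    typedCount F z (Function.update τ e 2) K =
      typedCount (F.erase e) (Function.update z e false) τ
          (fun x y w => K (Function.update x e false) (Function.update y e true)
            (Function.update w e true)) +
        typedCount (F.erase e) (Function.update z e false) τ
          (fun x y w => K (Function.update x e true) (Function.update y e false)
            (Function.update w e true)) +
        typedCount (F.erase e) (Function.update z e false) τ
          (fun x y w => K (Function.update x e true) (Function.update y e true)
            (Function.update w e false)) := by
  rw [typedCount_split F e he]
  simp only [Fintype.sum_bool, Bool.toNat_true, Bool.toNat_false, Function.update_self]
  norm_num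
  have hτ : ∀ K' : Config E → Config E → Config E → R,
      typedCount (F.erase e) (Function.update z e false) (Function.update τ e 2) K' =
        typedCount (F.erase e) (Function.update z e false) τ K' := fun K' =>
    typedCount_congr_τ _ _ (fun e' he' => by
      rw [Function.update_of_ne (Finset.ne_of_mem_erase he')]) K'
  rw [hτ, hτ, hτ]
  ring

end Split

/-! ## The quadratic identity of the typed bases -/

section Main

variable {V : Type*} {E : Type*} [Fintype E] [DecidableEq E] {R : Type*} [Field R]
variable (ends : E → Sym2 V) (o a₁ a₂ a₃ b : V)

/-- **The pendant-`a₃` quadratic identity**: for a typed edge `f = {a₃, u}` whose end `a₃` is a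
leaf carrying exactly the mark `a₃` (distinct from `o, a₁, a₂, b, u`), the typed bases with `f`
of types `0, 1, 2, 3` satisfy `N_{τ[f:=0]} + N_{τ[f:=2]} = N_{τ[f:=1]} + N_{τ[f:=3]}` — on every
finite graph, every pinning `z` and every type vector `τ`. -/
theorem typedCount_pendant_a3_quadratic {f : E} {u : V} (hf : ends f = s(a₃, u))
    (hleaf : ∀ e, a₃ ∈ ends e → e = f) (h3u : a₃ ≠ u) (h3o : a₃ ≠ o) (h31 : a₃ ≠ a₁)
    (h32 : a₃ ≠ a₂) (h3b : a₃ ≠ b) (F : Finset E) (hfF : f ∈ F) (z : Config E) (τ : E → ℕ) :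
    typedCount F z (Function.update τ f 0) (K3 ends o a₁ a₂ a₃ b : Config E → Config E → Config E → R) +
        typedCount F z (Function.update τ f 2) (K3 ends o a₁ a₂ a₃ b) =
      typedCount F z (Function.update τ f 1) (K3 ends o a₁ a₂ a₃ b) +
        typedCount F z (Function.update τ f 3) (K3 ends o a₁ a₂ a₃ b) := by
  set S := st ends o a₁ a₂ a₃ b with hS
  have hst : ∀ x : Config E, S (Function.update x f false) =
      kill3 (S (Function.update x f true)) := fun x =>
    st_update_pendant_a3 ends o a₁ a₂ a₃ b hf hleaf h3u h3o h31 h32 h3b x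
  rw [typedCount_split_zero F f hfF, typedCount_split_two F f hfF, typedCount_split_one F f hfF,
    typedCount_split_three F f hfF, ← typedCount_add, ← typedCount_add, ← typedCount_add,
    ← typedCount_add, ← typedCount_add, ← typedCount_add]
  refine typedCount_congr_K _ _ _ fun x y w => ?_
  simp only [K3_eq_KB, ← hS, hst]
  have h := congrArg (Int.cast : ℤ → R) (KB_pendant_a3 (S (Function.update x f true))
    (S (Function.update y f true)) (S (Function.update w f true)))
  push_cast at h ⊢
  linear_combination h

/-- **The candidate row (PM) — pendant monotonicity** (`proofs/NIGHT3-CERT.md` §15; a CANDIDATE of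
record, NOT a theorem: census 0 failures on every typed graph on `{o, a₁, a₂, b, u}` with ≤ 6
edges, all type vectors, and on the cell's boundary object): for a typed edge `f = {a₃, u}` whose
end `a₃` is a leaf carrying exactly the mark `a₃`, with `u` unmarked, the typed base with `f` of
type `1` dominates the base with `f` of type `0` (`a₃` isolated in every copy). By
`typedCount_pendant_a3_quadratic` this is equivalent to «type `2` dominates type `3`». -/
def PM (R : Type*) [Field R] [LinearOrder R] : Prop :=
  ∀ (V E : Type) [Fintype V] [DecidableEq V] [Fintype E] [DecidableEq E] (ends : E → Sym2 V)
    (o a₁ a₂ a₃ b u : V) (f : E), ends f = s(a₃, u) → (∀ e, a₃ ∈ ends e → e = f) →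
    a₃ ≠ u → a₃ ≠ o → a₃ ≠ a₁ → a₃ ≠ a₂ → a₃ ≠ b → u ≠ o → u ≠ a₁ → u ≠ a₂ → u ≠ b →
    ∀ (F : Finset E), f ∈ F → ∀ (z : Config E) (τ : E → ℕ), (∀ e ∈ F, τ e = 1 ∨ τ e = 2) →
      typedCount F z (Function.update τ f 0)
          (K3 ends o a₁ a₂ a₃ b : Config E → Config E → Config E → R) ≤
        typedCount F z (Function.update τ f 1) (K3 ends o a₁ a₂ a₃ b)

variable [LinearOrder R] [IsStrictOrderedRing R]

/-- **The pendant-`a₃` class from (PM)**: if the type-1 base dominates the isolated base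
(`hPM`, an instance of the candidate row (PM)), the isolated base is nonnegative (`h0`: the
`a₃`-inactive class, conditional on `TB14` by `A3InactiveTypedNR`) and the base with `a₃ := u`
is nonnegative (`h3`: the instance with one typed edge fewer), then both mixed bases of the
pendant instance are nonnegative: `0 ≤ N_{τ[f:=1]}` and `0 ≤ N_{τ[f:=2]}`. -/
theorem typedCount_pendant_a3_of_PM {f : E} {u : V} (hf : ends f = s(a₃, u))
    (hleaf : ∀ e, a₃ ∈ ends e → e = f) (h3u : a₃ ≠ u) (h3o : a₃ ≠ o) (h31 : a₃ ≠ a₁)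
    (h32 : a₃ ≠ a₂) (h3b : a₃ ≠ b) (F : Finset E) (hfF : f ∈ F) (z : Config E) (τ : E → ℕ)
    (hPM : typedCount F z (Function.update τ f 0)
        (K3 ends o a₁ a₂ a₃ b : Config E → Config E → Config E → R) ≤
      typedCount F z (Function.update τ f 1) (K3 ends o a₁ a₂ a₃ b))
    (h0 : 0 ≤ typedCount F z (Function.update τ f 0)
        (K3 ends o a₁ a₂ a₃ b : Config E → Config E → Config E → R))
    (h3 : 0 ≤ typedCount F z (Function.update τ f 3)
        (K3 ends o a₁ a₂ a₃ b : Config E → Config E → Config E → R)) :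
    0 ≤ typedCount F z (Function.update τ f 1)
        (K3 ends o a₁ a₂ a₃ b : Config E → Config E → Config E → R) ∧
      0 ≤ typedCount F z (Function.update τ f 2)
        (K3 ends o a₁ a₂ a₃ b : Config E → Config E → Config E → R) := by
  have hq := typedCount_pendant_a3_quadratic (R := R) ends o a₁ a₂ a₃ b hf hleaf h3u h3o h31 h32
    h3b F hfF z τ
  exact ⟨le_trans h0 hPM, by linarith⟩

end Main

end TypedRed

end CovForm

end Summit.Ventures.PercRepro2
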